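import Literature.NumberTheory.Transcendental.BallRivoalLinearForms
import HarnessLib

/-!
# Nesterenko's Proposition 1 at `z = 1`, `r = 1`: the series of a partial-fraction sum is a linear form in zeta values

Topic `Literature/NumberTheory/Transcendental`. [Nesterenko2008, §1] starts from a rational
function given by its partial fractions,
`R(s) = ∑_{ℓ ∈ 𝒫} ∑_{k=1}^{d(ℓ)} B_{ℓ,k} (s+ℓ)^{-k}` (`𝒫` "a set of distinct positive
integers", (1)), and [Nesterenko2008, Proposition 1] (= [Nesterenko2003, Proposition 1])
expands the generating series `G_r(z) = ((-1)^{r-1}/(r-1)!) ∑_{ν≥1} R^{(r-1)}(ν-a) z^ν` as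
`A₀(z⁻¹) + ∑_{k=1}^{q} A_k(z⁻¹) L_{k+r-1}(z)` with
`A_k(x) = C(k+r-2, r-1) ∑_{ℓ} B_{ℓ,k} x^{ℓ-a}` (3) and
`A₀(x) = -∑_ℓ ∑_k ∑_{ν=1}^{ℓ-a} C(k+r-2,r-1) B_{ℓ,k} ν^{1-k-r} x^{ℓ-a-ν}` (4).

This file PROVES the case used for linear forms in zeta values: `r = 1`, `z = x = 1`, `a = 1`
(so `G₁(1) = ∑_{ν ≥ 0} R(ν)`, `L_k(1) = ζ(k)`), under the convergence condition
`A₁(1) = ∑_ℓ B_{ℓ,1} = 0` (`R(s) = O(s⁻²)`):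

`∑_{ν=0}^{∞} R(ν) = ∑_{k ≥ 2} (∑_ℓ B_{ℓ,k}) ζ(k) - ∑_ℓ ∑_{k ≥ 1} B_{ℓ,k} H_{ℓ-1}^{(k)}`,
`H_m^{(k)} = ∑_{j=1}^{m} j^{-k}`

(`Nesterenko2008.hasSum_partialFractions`; `ζ(k) = zetaValue k` of `PeriodsWave0.lean`,
`H_m^{(k)} = BallRivoal.harm k m`). Together with `Nesterenko2008.BrickProduct.B_eq_of_partialFractions`,
`lemma5`, `lemma6` (`NesterenkoDenominators.lean`) this is the complete arithmetic skeleton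
"brick product ⇒ linear form in zeta values with controlled denominators" of
[Nesterenko2008, §§1–2] for `r = 1`. Everything here is PROVED (no named facts); the two
elementary series `∑_ν (ν+m+1)^{-k} = ζ(k) - H_m^{(k)}` and `∑_ν ((ν+1)⁻¹ - (ν+m+1)⁻¹) = H_m^{(1)}`
are the tree's `BallRivoal.hasSum_one_div_pow_shift` / `BallRivoal.hasSum_sub_shift`.

## References

* [Nesterenko2008] Yu. V. Nesterenko, *Construction of approximations to zeta-values*, in:
  Diophantine Approximation (Festschrift W. Schmidt), Dev. Math. 16, Springer 2008, 275–293,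
  §1 (1)–(4), Proposition 1 p. 275–276.
* [Nesterenko2003] Yu. V. Nesterenko, *Integral identities and constructions of approximations
  to zeta-values*, J. Théor. Nombres Bordeaux 15 (2003), 535–550, Proposition 1.
-/

noncomputable section

open Finset Filter Topology
open scoped Nat

namespace Literature.NumberTheory.Transcendental

namespace Nesterenko2008

open BallRivoal (harm hasSum_one_div_pow_shift hasSum_sub_shift)

/-- Splitting off the term `k = 1` of a sum over `1 ≤ k ≤ e`. [folklore] -/
private theorem sum_Icc_one_split {M : Type*} [AddCommMonoid M] (e : ℕ) (f : ℕ → M) :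
    ∑ k ∈ Icc 1 e, f k = (∑ k ∈ Icc 2 e, f k) + if 1 ≤ e then f 1 else 0 := by
  by_cases he : 1 ≤ e
  · rw [if_pos he, ← Finset.insert_Icc_succ_left_eq_Icc he, sum_insert (by simp), add_comm]
    rfl
  · rw [if_neg he, Icc_eq_empty (by omega), Icc_eq_empty (by omega)]
    simp

/-- **[Nesterenko2008, Proposition 1]** for `r = 1` at `z = 1` (linear forms in zeta values from
partial fractions). Let `𝒫 = L` be a finite set of positive integers and
`R(s) = ∑_{ℓ ∈ L} ∑_{k=1}^{e(ℓ)} c_{ℓ,k} (s+ℓ)^{-k}` with `∑_{ℓ : e(ℓ) ≥ 1} c_{ℓ,1} = 0`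
(i.e. `A₁(1) = 0`, `R(s) = O(s⁻²)`). Then `∑_{ν=0}^{∞} R(ν)` converges and equals
`∑_ℓ ∑_{k=2}^{e(ℓ)} c_{ℓ,k} ζ(k) - ∑_ℓ ∑_{k=1}^{e(ℓ)} c_{ℓ,k} H_{ℓ-1}^{(k)}`, i.e.
`G₁(1) = A₀(1) + ∑_{k ≥ 2} A_k(1) ζ(k)` with `A_k(1) = ∑_ℓ B_{ℓ,k}` (3) and
`A₀(1) = -∑_ℓ ∑_k B_{ℓ,k} ∑_{ν=1}^{ℓ-1} ν^{-k}` (4) (`a = 1`).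
[cite: Nesterenko2008, §1 Proposition 1 with (3)–(4) p. 275–276] -/
theorem hasSum_partialFractions (L : Finset ℕ) (hL : ∀ ℓ ∈ L, 1 ≤ ℓ) (e : ℕ → ℕ)
    (c : ℕ → ℕ → ℚ) (h1 : ∑ ℓ ∈ L with 1 ≤ e ℓ, c ℓ 1 = 0) :
    HasSum (fun ν : ℕ => ∑ ℓ ∈ L, ∑ k ∈ Icc 1 (e ℓ), (c ℓ k : ℝ) / ((ν : ℝ) + ℓ) ^ k)
      ((∑ ℓ ∈ L, ∑ k ∈ Icc 2 (e ℓ), (c ℓ k : ℝ) * zetaValue k) -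
        ∑ ℓ ∈ L, ∑ k ∈ Icc 1 (e ℓ), (c ℓ k : ℝ) * (harm k (ℓ - 1) : ℝ)) := by
  -- the shift `ν + (ℓ-1) + 1 = ν + ℓ`
  have hshift : ∀ ℓ ∈ L, ∀ ν : ℕ, (ν : ℝ) + ((ℓ - 1 : ℕ) : ℝ) + 1 = (ν : ℝ) + ℓ := by
    intro ℓ hℓ ν
    have : ((ℓ - 1 : ℕ) : ℝ) + 1 = ℓ := by exact_mod_cast Nat.sub_add_cancel (hL ℓ hℓ)
    rw [add_assoc, this]
  -- higher-order poles: `∑_ν c/(ν+ℓ)^k = c (ζ(k) - H_{ℓ-1}^{(k)})`, `k ≥ 2`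
  have hA : HasSum (fun ν : ℕ => ∑ ℓ ∈ L, ∑ k ∈ Icc 2 (e ℓ), (c ℓ k : ℝ) / ((ν : ℝ) + ℓ) ^ k)
      (∑ ℓ ∈ L, ∑ k ∈ Icc 2 (e ℓ), (c ℓ k : ℝ) * (zetaValue k - (harm k (ℓ - 1) : ℝ))) := by
    refine hasSum_sum fun ℓ hℓ => hasSum_sum fun k hk => ?_
    have hk2 : 2 ≤ k := (mem_Icc.1 hk).1
    have h := (hasSum_one_div_pow_shift k (ℓ - 1) hk2).mul_left (c ℓ k : ℝ)
    refine h.congr_fun fun ν => ?_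
    rw [hshift ℓ hℓ ν, div_eq_mul_one_div]
  -- simple poles: `∑_ν ∑_ℓ c_{ℓ,1}/(ν+ℓ) = -∑_ℓ c_{ℓ,1} H_{ℓ-1}` since `∑_ℓ c_{ℓ,1} = 0`
  set L₁ := L.filter fun ℓ => 1 ≤ e ℓ with hL₁
  have hB : HasSum (fun ν : ℕ => ∑ ℓ ∈ L₁, -((c ℓ 1 : ℝ) *
        (1 / ((ν : ℝ) + 1) - 1 / ((ν : ℝ) + ((ℓ - 1 : ℕ) : ℝ) + 1))))
      (∑ ℓ ∈ L₁, -((c ℓ 1 : ℝ) * (harm 1 (ℓ - 1) : ℝ))) :=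
    hasSum_sum fun ℓ _ => ((hasSum_sub_shift (ℓ - 1)).mul_left (c ℓ 1 : ℝ)).neg
  have h1R : ∑ ℓ ∈ L₁, (c ℓ 1 : ℝ) = 0 := by
    rw [hL₁]
    exact_mod_cast h1
  have hBfun : ∀ ν : ℕ, ∑ ℓ ∈ L₁, -((c ℓ 1 : ℝ) *
        (1 / ((ν : ℝ) + 1) - 1 / ((ν : ℝ) + ((ℓ - 1 : ℕ) : ℝ) + 1))) =
      ∑ ℓ ∈ L, if 1 ≤ e ℓ then (c ℓ 1 : ℝ) / ((ν : ℝ) + ℓ) ^ 1 else 0 := by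
    intro ν
    rw [← sum_filter, ← hL₁]
    have hL₁L : ∀ ℓ ∈ L₁, ℓ ∈ L := fun ℓ hℓ => (mem_filter.1 (by rw [hL₁] at hℓ; exact hℓ)).1
    calc ∑ ℓ ∈ L₁, -((c ℓ 1 : ℝ) * (1 / ((ν : ℝ) + 1) - 1 / ((ν : ℝ) + ((ℓ - 1 : ℕ) : ℝ) + 1)))
        = ∑ ℓ ∈ L₁, ((c ℓ 1 : ℝ) / ((ν : ℝ) + ℓ) ^ 1 - (c ℓ 1 : ℝ) * (1 / ((ν : ℝ) + 1))) := by
          refine sum_congr rfl fun ℓ hℓ => ?_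
          rw [hshift ℓ (hL₁L ℓ hℓ) ν, pow_one]
          ring
      _ = ∑ ℓ ∈ L₁, (c ℓ 1 : ℝ) / ((ν : ℝ) + ℓ) ^ 1 -
            (∑ ℓ ∈ L₁, (c ℓ 1 : ℝ)) * (1 / ((ν : ℝ) + 1)) := by
          rw [sum_sub_distrib, sum_mul]
      _ = ∑ ℓ ∈ L₁, (c ℓ 1 : ℝ) / ((ν : ℝ) + ℓ) ^ 1 := by rw [h1R, zero_mul, sub_zero]
  -- assemble
  have hsum := hA.add hB
  have hfun : (fun ν : ℕ => ∑ ℓ ∈ L, ∑ k ∈ Icc 1 (e ℓ), (c ℓ k : ℝ) / ((ν : ℝ) + ℓ) ^ k) =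
      fun ν : ℕ => (∑ ℓ ∈ L, ∑ k ∈ Icc 2 (e ℓ), (c ℓ k : ℝ) / ((ν : ℝ) + ℓ) ^ k) +
        ∑ ℓ ∈ L₁, -((c ℓ 1 : ℝ) *
          (1 / ((ν : ℝ) + 1) - 1 / ((ν : ℝ) + ((ℓ - 1 : ℕ) : ℝ) + 1))) := by
    funext ν
    rw [hBfun ν, ← sum_add_distrib]
    exact sum_congr rfl fun ℓ _ => sum_Icc_one_split (e ℓ) _
  have hval : (∑ ℓ ∈ L, ∑ k ∈ Icc 2 (e ℓ), (c ℓ k : ℝ) * zetaValue k) -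
        ∑ ℓ ∈ L, ∑ k ∈ Icc 1 (e ℓ), (c ℓ k : ℝ) * (harm k (ℓ - 1) : ℝ) =
      (∑ ℓ ∈ L, ∑ k ∈ Icc 2 (e ℓ), (c ℓ k : ℝ) * (zetaValue k - (harm k (ℓ - 1) : ℝ))) +
        ∑ ℓ ∈ L₁, -((c ℓ 1 : ℝ) * (harm 1 (ℓ - 1) : ℝ)) := by
    have hH : ∑ ℓ ∈ L, ∑ k ∈ Icc 1 (e ℓ), (c ℓ k : ℝ) * (harm k (ℓ - 1) : ℝ) =
        (∑ ℓ ∈ L, ∑ k ∈ Icc 2 (e ℓ), (c ℓ k : ℝ) * (harm k (ℓ - 1) : ℝ)) +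
          ∑ ℓ ∈ L₁, (c ℓ 1 : ℝ) * (harm 1 (ℓ - 1) : ℝ) := by
      rw [hL₁, sum_filter, ← sum_add_distrib]
      exact sum_congr rfl fun ℓ _ => sum_Icc_one_split (e ℓ) _
    rw [hH, sum_neg_distrib]
    simp only [mul_sub, sum_sub_distrib]
    ring
  rw [hfun, hval]
  exact hsum

/-! ### The derivatives: `r ≥ 2` -/

/-- Smoothness of `(s+ℓ)^{-k}` away from `-ℓ`. [folklore] -/
private theorem contDiffAt_inv_pow (ℓ k : ℕ) {y : ℝ} (hy : y + ℓ ≠ 0) {N : WithTop ℕ∞} :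
    ContDiffAt ℝ N (fun s : ℝ => ((s + ℓ) ^ k)⁻¹) y :=
  ((contDiffAt_id.add contDiffAt_const).pow k).inv (pow_ne_zero _ hy)

/-- `(d/ds)^m (s+ℓ)^{-k} = (-1)^m k(k+1)⋯(k+m-1) (s+ℓ)^{-k-m}` (with Mathlib's junk value
`0⁻¹ = 0` this holds at every point). [folklore] -/
private theorem iteratedDeriv_inv_pow (ℓ k m : ℕ) (y : ℝ) :
    iteratedDeriv m (fun s : ℝ => ((s + ℓ) ^ k)⁻¹) y =
      (-1) ^ m * (k.ascFactorial m : ℝ) * ((y + ℓ) ^ (k + m))⁻¹ := by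
  have hfun : (fun s : ℝ => ((s + ℓ) ^ k)⁻¹) = fun s => (fun x : ℝ => x ^ (-(k : ℤ))) (s + ℓ) := by
    funext s
    simp only [zpow_neg, zpow_natCast]
  rw [hfun, iteratedDeriv_comp_add_const m (fun x : ℝ => x ^ (-(k : ℤ))) (ℓ : ℝ)]
  simp only
  rw [iteratedDeriv_eq_iterate, iter_deriv_zpow,
    show (-(k : ℤ) - (m : ℕ)) = -((k + m : ℕ) : ℤ) by push_cast; ring, zpow_neg, zpow_natCast]
  congr 1
  rw [Nat.ascFactorial_eq_prod_range, Nat.cast_prod, ← card_range m, ← prod_const, card_range,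
    ← prod_mul_distrib]
  refine prod_congr rfl fun i _ => ?_
  push_cast
  ring

/-- **[Nesterenko2008, Proposition 1]** for `r = m + 1 ≥ 2` at `z = 1` (the derivatives): for a
finite set `L` of positive integers and `R(s) = ∑_{ℓ ∈ L} ∑_{k=1}^{e(ℓ)} c_{ℓ,k} (s+ℓ)^{-k}`,
`G_r(1) = ((-1)^{r-1}/(r-1)!) ∑_{ν ≥ 0} R^{(r-1)}(ν)` converges (no condition: all exponents are
`≥ 2`) and equals `∑_ℓ ∑_k C(k+r-2, r-1) c_{ℓ,k} (ζ(k+r-1) - H_{ℓ-1}^{(k+r-1)})`, i.e.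
`A₀(1) + ∑_k A_k(1) ζ(k+r-1)` with `A_k(1) = C(k+r-2,r-1) ∑_ℓ B_{ℓ,k}` (3) and
`A₀(1) = -∑_ℓ ∑_k ∑_{ν=1}^{ℓ-1} C(k+r-2,r-1) B_{ℓ,k} ν^{1-k-r}` (4) (`a = 1`). (Termwise
`(d/ds)^{r-1}(s+ℓ)^{-k} = (-1)^{r-1}(k)_{r-1}(s+ℓ)^{-k-r+1}`, then the case `r = 1`.)
[cite: Nesterenko2008, §1 Proposition 1 with (3)–(4) p. 275–276] -/
theorem hasSum_iteratedDeriv_partialFractions (L : Finset ℕ) (hL : ∀ ℓ ∈ L, 1 ≤ ℓ) (e : ℕ → ℕ)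
    (c : ℕ → ℕ → ℚ) (m : ℕ) (hm : 1 ≤ m) :
    HasSum (fun ν : ℕ => (-1) ^ m / (m ! : ℝ) *
        iteratedDeriv m (fun s : ℝ => ∑ ℓ ∈ L, ∑ k ∈ Icc 1 (e ℓ), (c ℓ k : ℝ) / (s + ℓ) ^ k) ν)
      (∑ ℓ ∈ L, ∑ k ∈ Icc 1 (e ℓ), (c ℓ k : ℝ) * ((k + m - 1).choose m : ℝ) *
        (zetaValue (k + m) - (harm (k + m) (ℓ - 1) : ℝ))) := by
  have hshift : ∀ ℓ ∈ L, ∀ ν : ℕ, (ν : ℝ) + ((ℓ - 1 : ℕ) : ℝ) + 1 = (ν : ℝ) + ℓ := by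
    intro ℓ hℓ ν
    have : ((ℓ - 1 : ℕ) : ℝ) + 1 = ℓ := by exact_mod_cast Nat.sub_add_cancel (hL ℓ hℓ)
    rw [add_assoc, this]
  have hpos : ∀ ℓ ∈ L, ∀ ν : ℕ, (ν : ℝ) + ℓ ≠ 0 := by
    intro ℓ hℓ ν
    have : (1 : ℝ) ≤ ℓ := by exact_mod_cast hL ℓ hℓ
    positivity
  have hm0 : (m ! : ℝ) ≠ 0 := by exact_mod_cast (Nat.factorial_pos m).ne'
  -- the derivative termwise
  have hderiv : ∀ ν : ℕ, (-1) ^ m / (m ! : ℝ) *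
      iteratedDeriv m (fun s : ℝ => ∑ ℓ ∈ L, ∑ k ∈ Icc 1 (e ℓ), (c ℓ k : ℝ) / (s + ℓ) ^ k) ν =
      ∑ ℓ ∈ L, ∑ k ∈ Icc 1 (e ℓ), (c ℓ k : ℝ) * ((k + m - 1).choose m : ℝ) *
        (1 / ((ν : ℝ) + ((ℓ - 1 : ℕ) : ℝ) + 1) ^ (k + m)) := by
    intro ν
    have hfun : (fun s : ℝ => ∑ ℓ ∈ L, ∑ k ∈ Icc 1 (e ℓ), (c ℓ k : ℝ) / (s + ℓ) ^ k) =
        fun s : ℝ => ∑ ℓ ∈ L, ∑ k ∈ Icc 1 (e ℓ), (c ℓ k : ℝ) * ((s + ℓ) ^ k)⁻¹ := by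
      funext s
      simp only [div_eq_mul_inv]
    rw [hfun, iteratedDeriv_fun_sum fun ℓ hℓ => ContDiffAt.sum fun k _ =>
      contDiffAt_const.mul (contDiffAt_inv_pow ℓ k (hpos ℓ hℓ ν)), mul_sum]
    refine sum_congr rfl fun ℓ hℓ => ?_
    rw [iteratedDeriv_fun_sum fun k _ => contDiffAt_const.mul (contDiffAt_inv_pow ℓ k (hpos ℓ hℓ ν)),
      mul_sum]
    refine sum_congr rfl fun k hk => ?_
    have hk1 : 1 ≤ k := (mem_Icc.1 hk).1
    rw [iteratedDeriv_const_mul _ (contDiffAt_inv_pow ℓ k (hpos ℓ hℓ ν)),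
      iteratedDeriv_inv_pow ℓ k m, hshift ℓ hℓ ν,
      Nat.ascFactorial_eq_factorial_mul_choose']
    have h11 : ((-1 : ℝ) ^ m) * (-1) ^ m = 1 := by rw [← mul_pow]; simp
    push_cast
    calc (-1) ^ m / (m ! : ℝ) * ((c ℓ k : ℝ) * ((-1) ^ m * ((m ! : ℝ) * ((k + m - 1).choose m : ℝ)) *
          (((ν : ℝ) + ℓ) ^ (k + m))⁻¹))
        = ((-1 : ℝ) ^ m * (-1) ^ m) * ((m ! : ℝ) / m !) *
            ((c ℓ k : ℝ) * ((k + m - 1).choose m : ℝ) * (((ν : ℝ) + ℓ) ^ (k + m))⁻¹) := by ring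
      _ = (c ℓ k : ℝ) * ((k + m - 1).choose m : ℝ) * (1 / ((ν : ℝ) + ℓ) ^ (k + m)) := by
          rw [h11, div_self hm0, one_div]
          ring
  -- the series termwise
  have hseries : HasSum (fun ν : ℕ => ∑ ℓ ∈ L, ∑ k ∈ Icc 1 (e ℓ), (c ℓ k : ℝ) *
        ((k + m - 1).choose m : ℝ) * (1 / ((ν : ℝ) + ((ℓ - 1 : ℕ) : ℝ) + 1) ^ (k + m)))
      (∑ ℓ ∈ L, ∑ k ∈ Icc 1 (e ℓ), (c ℓ k : ℝ) * ((k + m - 1).choose m : ℝ) *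
        (zetaValue (k + m) - (harm (k + m) (ℓ - 1) : ℝ))) := by
    refine hasSum_sum fun ℓ _ => hasSum_sum fun k hk => ?_
    have hk1 : 1 ≤ k := (mem_Icc.1 hk).1
    exact (hasSum_one_div_pow_shift (k + m) (ℓ - 1) (by omega)).mul_left _
  refine hseries.congr_fun fun ν => ?_
  exact hderiv ν

end Nesterenko2008

end Literature.NumberTheory.Transcendental
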